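import Literature.NumberTheory.PAdicHodge.KummerCocycleMatchingO
import HarnessLib

/-!
# The inclusion `ι : T_pŴ(𝒪_{ℂ_F}) ↪ T_pE(F̄)` of the FORMAL Tate module of a good `𝒪_F`-model WITHOUT the hypothesis
# `E[p^∞] ⊂ E₁` (ordinary / height-one models), its `Γ_F`-equivariance, and the Kummer cocycle of a formal division tower read through `ι`

Topic `Literature/NumberTheory/PAdicHodge`; namespace `Literature.NumberTheory.PAdicHodge.AinfTop`. THEOREMS ONLY (no definition, no named fact, no
instance, no `sorry`). `AinfWeierstrassTateModuleGeomO` matched `T_pE(F̄) ≃ T_pŴ(𝒪_{ℂ_F}) = TatePtO F W p` under `hss : E[pⁿ](ℂ_F) ⊂ E₁(ℂ_F)`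
(good SUPERSINGULAR reduction). For a good ORDINARY model `hss` fails (the formal group has height one, `T_pŴ` has rank one inside the rank-two
`T_pE`); what survives is the INCLUSION, which is all the unit-root frame of Kato's reciprocity law needs (memo
`Summits/BirchSwinnertonDyer/BirchSwinnertonDyer/Cruxes/StarredOptimalManinUnitFiveSeven/Lines/kato-lever-seam-rec-at-cells.md` §17, brick B2):

* §1 `galPointCO_ptOfZ` — **`σ(P(t)) = P(σt)`** on `E(ℂ_F)` (AEC VII.2.2's `E₁ ≅ Ŵ(𝔪)` is `Γ_F`-equivariant, `kernelEquivPt_galPointHom`);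
  `tateModuleOfPt_smul` — `T_p(t ↦ P(t))` intertwines `tatePtORep` with `T_p(σ)` on `T_pE(ℂ_F)`.
* §2 ★ `tateGeomEquivCO_symm_tateModuleOfPt_injective`, ★ `tateGeomEquivCO_symm_tateModuleOfPt_smul` — the composite
  **`ι = tateGeomEquivCO⁻¹ ∘ tateModuleOfPt : T_pŴ(𝒪_{ℂ_F}) → T_pE(F̄)`** is injective and `Γ_F`-equivariant (`ι(σ • τ) = σ • ι(τ)`), for ANY
  `𝒪_F`-model with `Δ ∈ 𝒪_Fˣ` — no supersingularity; `tateGeomEquivCO_symm_tateModuleOfPt_smul_mem` — saturation: `p • y ∈ ι(T_pŴ) ⇒ y ∈ ι(T_pŴ)`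
  is NOT needed by the frame and not proved here.
* §3 ★★ `tateModuleOfPt_kummerCocycleO` — for a `p`-power division sequence `Q` of `E(F̄)` lying in `E₁(ℂ_F)` with `Γ_F`-fixed `Q₀` (`𝒪_D`-currency
  `W♭ = W ⊗_ψ 𝒪_F`): **`ι(κ_u(σ)) = (σQₙ − Qₙ)ₙ`**, `uₙ = z(Qₙ)`, `κ_u = AinfRamTop.kummerCocycleO` — the ordinary twin of
  `tateGeomEquivTatePtOSS_kummer` (there `e = ι⁻¹`).

BSD / K★ (`stmt-BirchSwinnertonDyer-22226`, stub `stub_localFormulaOrdinaryCells`): infrastructure; nothing about elliptic curves over number fields is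
proved here.

## References
* J. H. Silverman, *The Arithmetic of Elliptic Curves* (2009), III.§7, Prop. VII.2.1–VII.2.2, VIII.§2. [SilvermanAEC2009]
* J. Tate, *p-divisible groups* (1967), §4 (the connected–étale sequence `0 → T_pÊ → T_pE → T_pE^{ét} → 0`). [Tate1967]
-/

noncomputable section

open scoped Classical

namespace Literature.NumberTheory.PAdicHodge

open Literature Literature.NumberTheory.GaloisRepresentations Literature.NumberTheory.EllipticCurves WeierstrassCurve
open Literature.NumberTheory.GaloisRepresentations.IsNonarchimedeanLocalField Field ValuativeRel
open Literature.NumberTheory.GaloisRepresentations.LubinTate Literature.NumberTheory.EllipticCurves.FormalGroupChart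

namespace AinfTop

section Inclusion

variable {F : Type} [Field F] [ValuativeRel F] [TopologicalSpace F] [IsNonarchimedeanLocalField F] [CharZero F]
  (W : WeierstrassCurve (LTCoeff F)) {p : ℕ} [Fact p.Prime] [hE : (curveOver (CompletedAlgClosure F) W).IsElliptic]

/-! ## §1 `σ(P(t)) = P(σ t)` -/

omit [CharZero F] [Fact p.Prime] in
/-- **`σ(P(t)) = P(σ • t)`**: the formal-group chart `t ↦ P(t) ∈ E₁(ℂ_F)` (AEC VII.2.2) commutes with `Γ_F` (`W` over `𝒪_F`).
[cite: SilvermanAEC2009, Prop. VII.2.2] -/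
theorem galPointCO_ptOfZ (σ : absoluteGaloisGroup F) (t : (maxNilIdealC F).toIdeal) :
    galPointCO W σ (ptOfZ (CompletedAlgClosure F) W t) = ptOfZ (CompletedAlgClosure F) W (σ • (⟨t⟩ : W.Pt (maxNilIdealC F))).val := by
  have hP : ptOfZ (CompletedAlgClosure F) W t ∈
      kernel (NormedField.valuation (K := CompletedAlgClosure F)) (curveOver (CompletedAlgClosure F) W) := ptOfZ_mem_kernel t
  have hσP : galPointCO W σ (ptOfZ (CompletedAlgClosure F) W t) ∈
      kernel (NormedField.valuation (K := CompletedAlgClosure F)) (curveOver (CompletedAlgClosure F) W) :=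
    galPointHom_mem_kernel (CompletedAlgClosure.galRingHom σ) (galRingHom_cK_ltCoeff σ) (norm_galRingHom σ) (@hP)
  have hkey := kernelEquivPt_galPointHom (CompletedAlgClosure.galRingHom σ) (galRingHom_cK_ltCoeff σ) (norm_galRingHom σ)
    (galCBallCoeffAlgHom σ) (continuous_galCBall σ) (fun _ hx => galCBall_mem hx) (fun _ => rfl)
    ⟨ptOfZ (CompletedAlgClosure F) W t, hP⟩
  -- `kernelEquivPt ⟨P(t), _⟩ = ⟨t⟩`
  have ht : kernelEquivPt (CompletedAlgClosure F) W ⟨ptOfZ (CompletedAlgClosure F) W t, hP⟩ = (⟨t⟩ : W.Pt (maxNilIdealC F)) :=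
    WeierstrassCurve.Pt.ext (by rw [kernelEquivPt_apply_val]; exact zPt_ptOfZ t)
  rw [ht] at hkey
  calc galPointCO W σ (ptOfZ (CompletedAlgClosure F) W t)
      = ptOfZ (CompletedAlgClosure F) W (zPt (galPointCO W σ (ptOfZ (CompletedAlgClosure F) W t)) hσP) := eq_ptOfZ_zPt hσP
    _ = ptOfZ (CompletedAlgClosure F) W
          (kernelEquivPt (CompletedAlgClosure F) W ⟨galPointCO W σ (ptOfZ (CompletedAlgClosure F) W t), hσP⟩).val := by
        rw [kernelEquivPt_apply_val]
    _ = ptOfZ (CompletedAlgClosure F) W (σ • (⟨t⟩ : W.Pt (maxNilIdealC F))).val := by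
        change ptOfZ _ W (kernelEquivPt (CompletedAlgClosure F) W ⟨galPointHom _ _ _, hσP⟩).val = _
        rw [hkey]; rfl

omit [CharZero F] in
/-- **`T_p(t ↦ P(t))` is `Γ_F`-equivariant**: `tateModuleOfPt (σ • τ) = T_p(σ) (tateModuleOfPt τ)` on `T_pŴ(𝒪_{ℂ_F}) → T_pE(ℂ_F)`.
[cite: SilvermanAEC2009, Prop. VII.2.2] [cite: Tate1967, §4] -/
theorem tateModuleOfPt_smul (σ : absoluteGaloisGroup F) (τ : TatePtO F W p) :
    tateModuleOfPt (CompletedAlgClosure F) W p (σ • τ) = TateModule.map p (galPointCO W σ) (tateModuleOfPt (CompletedAlgClosure F) W p τ) := by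
  refine TateModule.ext fun n => ?_
  have h : TateModule.proj p n (σ • τ) = σ • TateModule.proj p n τ := TateModule.proj_smul_of_distribMulAction σ τ n
  rw [TateModule.proj_map, proj_tateModuleOfPt, proj_tateModuleOfPt, galPointCO_ptOfZ]
  exact congrArg (fun P : W.Pt (maxNilIdealC F) => ptOfZ (CompletedAlgClosure F) W P.val) h

/-! ## §2 `ι = tateGeomEquivCO⁻¹ ∘ tateModuleOfPt : T_pŴ(𝒪_{ℂ_F}) ↪ T_pE(F̄)` -/

/-- ★ **`ι` is injective** (`Δ ∈ 𝒪_Fˣ`; no supersingularity). [cite: SilvermanAEC2009, Prop. VII.2.2] -/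
theorem tateGeomEquivCO_symm_tateModuleOfPt_injective (hΔ : IsUnit W.Δ) :
    Function.Injective fun τ : TatePtO F W p => (tateGeomEquivCO F W p hΔ).symm (tateModuleOfPt (CompletedAlgClosure F) W p τ) :=
  (tateGeomEquivCO F W p hΔ).symm.injective.comp tateModuleOfPt_injective

/-- ★ **`ι` is `Γ_F`-equivariant**: `ι(σ • τ) = σ • ι(τ)` with the action of `Γ_F` on `T_pE(F̄)`. [cite: SilvermanAEC2009, III.§7 and Prop. VII.2.2]
[cite: Tate1967, §4] -/
theorem tateGeomEquivCO_symm_tateModuleOfPt_smul (hΔ : IsUnit W.Δ) (σ : absoluteGaloisGroup F) (τ : TatePtO F W p) :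
    (tateGeomEquivCO F W p hΔ).symm (tateModuleOfPt (CompletedAlgClosure F) W p (σ • τ)) =
      σ • (tateGeomEquivCO F W p hΔ).symm (tateModuleOfPt (CompletedAlgClosure F) W p τ) := by
  apply (tateGeomEquivCO F W p hΔ).injective
  rw [LinearEquiv.apply_symm_apply, tateGeomEquivCO_smul, LinearEquiv.apply_symm_apply, tateModuleOfPt_smul]

/-- The same with the representation `galoisRepTate`. [cite: Tate1967, §4] -/
theorem tateGeomEquivCO_symm_tateModuleOfPt_galoisRepTate (hΔ : IsUnit W.Δ) (σ : absoluteGaloisGroup F) (τ : TatePtO F W p) :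
    (curveFO F W).galoisRepTate p σ ((tateGeomEquivCO F W p hΔ).symm (tateModuleOfPt (CompletedAlgClosure F) W p τ)) =
      (tateGeomEquivCO F W p hΔ).symm (tateModuleOfPt (CompletedAlgClosure F) W p (tatePtORep F W p σ τ)) := by
  rw [WeierstrassCurve.galoisRepTate_apply_apply, tatePtORep_apply_apply, tateGeomEquivCO_symm_tateModuleOfPt_smul]

end Inclusion

/-! ## §3 The Kummer cocycle of a formal division tower through `ι` -/

section Kummer

variable {F : Type} [Field F] [ValuativeRel F] [TopologicalSpace F] [IsNonarchimedeanLocalField F] [CharZero F]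
  {p : ℕ} [Fact p.Prime] {hp : valuation F p < 1} {D : EisensteinRoot F p hp}
  (W : WeierstrassCurve (EisensteinRoot.CoeffDisc D)) (ψ : EisensteinRoot.CoeffDisc D →+* LTCoeff F)
  [hE : (curveOver (CompletedAlgClosure F) (W.map ψ)).IsElliptic]

/-- ★★ **`ι(κ_u(σ)) = (σQₙ − Qₙ)ₙ`** read on `T_pE(ℂ_F)`: for a `p`-power division sequence `Q` in `E(F̄)` lying in `E₁(ℂ_F)` with `Γ_F`-fixed `Q₀`
and `uₙ = z(Qₙ)`, `tateModuleOfPt (κ_u σ) = tateGeomEquivCO ((σQₙ − Qₙ)ₙ)` — the algebraic Kummer element IS the image of the formal Kummer cocycle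
`AinfRamTop.kummerCocycleO` under `ι` (ordinary twin of `tateGeomEquivTatePtOSS_kummer`; no supersingularity). [cite: SilvermanAEC2009, Prop. VII.2.2 and VIII.§2]
[cite: BlochKato1990, Ex. 3.10.1] -/
theorem tateModuleOfPt_kummerCocycleO (hψ : ∀ c, algebraMap (LTCoeff F) F (ψ c) = EisensteinRoot.CoeffDisc.toF D c) (hΔ : IsUnit (W.map ψ).Δ)
    {Q : ℕ → (curveFO F (W.map ψ)).geomPoints} (hQ : ∀ n, p • Q (n + 1) = Q n) (hfix : ∀ σ : absoluteGaloisGroup F, σ • Q 0 = Q 0)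
    (hker : ∀ n, geomToCO (W.map ψ) (Q n) ∈
      kernel (NormedField.valuation (K := CompletedAlgClosure F)) (curveOver (CompletedAlgClosure F) (W.map ψ)))
    (σ : absoluteGaloisGroup F) :
    tateModuleOfPt (CompletedAlgClosure F) (W.map ψ) p
        (AinfRamTop.kummerCocycleO W ψ hψ (fun n => zPt (geomToCO (W.map ψ) (Q n)) (hker n))
          (mulPC_zPt_divSeqO W ψ hψ hQ hker) (galCBall_zPt_divSeqO_zero W ψ hfix hker) σ) =
      tateGeomEquivCO F (W.map ψ) p hΔ
        (TateModule.mk (fun n => σ • Q n - Q n) (pow_smul_kummerO_eq_zero W ψ hQ hfix σ) (smul_kummerO_succ W ψ hQ σ)) := by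
  refine TateModule.ext fun n => ?_
  -- left: `P((σ•⟨uₙ⟩ − ⟨uₙ⟩).val) = P(σ•uₙ) − P(uₙ) = σ P(uₙ) − P(uₙ)` (`ptHom` additive, §1) and `P(z(Qₙ)) = Qₙ`
  have hκ := AinfRamTop.proj_kummerCocycleO W ψ (hψ := hψ) (u := fun n => zPt (geomToCO (W.map ψ) (Q n)) (hker n))
    (hup := mulPC_zPt_divSeqO W ψ hψ hQ hker) (hu₀ := galCBall_zPt_divSeqO_zero W ψ hfix hker) σ n
  have hL : TateModule.proj p n (tateModuleOfPt (CompletedAlgClosure F) (W.map ψ) p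
      (AinfRamTop.kummerCocycleO W ψ hψ (fun n => zPt (geomToCO (W.map ψ) (Q n)) (hker n))
        (mulPC_zPt_divSeqO W ψ hψ hQ hker) (galCBall_zPt_divSeqO_zero W ψ hfix hker) σ)) =
      galPointCO (W.map ψ) σ (geomToCO (W.map ψ) (Q n)) - geomToCO (W.map ψ) (Q n) := by
    rw [proj_tateModuleOfPt]
    have h2 := congrArg (fun P : (W.map ψ).Pt (maxNilIdealC F) => ptOfZ (CompletedAlgClosure F) (W.map ψ) P.val) hκ
    refine h2.trans ?_
    set P₀ : (W.map ψ).Pt (maxNilIdealC F) := ⟨zPt (geomToCO (W.map ψ) (Q n)) (hker n)⟩ with hP₀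
    have h3 : ptHom (CompletedAlgClosure F) (W.map ψ) (σ • P₀ - P₀) =
        ptHom (CompletedAlgClosure F) (W.map ψ) (σ • P₀) - ptHom (CompletedAlgClosure F) (W.map ψ) P₀ := map_sub _ _ _
    simp only [ptHom_apply] at h3
    refine h3.trans ?_
    rw [← galPointCO_ptOfZ, hP₀, ← eq_ptOfZ_zPt (hker n)]
  have hR : TateModule.proj p n (tateGeomEquivCO F (W.map ψ) p hΔ
      (TateModule.mk (fun n => σ • Q n - Q n) (pow_smul_kummerO_eq_zero W ψ hQ hfix σ) (smul_kummerO_succ W ψ hQ σ))) =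
      galPointCO (W.map ψ) σ (geomToCO (W.map ψ) (Q n)) - geomToCO (W.map ψ) (Q n) := by
    rw [proj_tateGeomEquivCO, TateModule.proj_mk, map_sub, geomToCO_smul]
  exact hL.trans hR.symm

end Kummer

end AinfTop

end Literature.NumberTheory.PAdicHodge

end
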